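import Literature.NumberTheory.DiophantineGeometry.StewartYuPadicLogFormsProofs
import Literature.Barriers.ABC.BakerMethodBoundsStewartTijdemanGenericProofs

/-!
# BC5 rung for the staged M2 route `PadicPrimesYuNinety`: the one-prime-set case `#S = 1`

`yuNinetyPrimes_card_one`: the crux `YuNinetyPrimes` (verbatim the binder `hY` of
`Literature.Barriers.ABC.stewartYu1991_of_yu1990`) restricted to `S.card ≤ 1`, i.e. one logarithm,
with the absolute constant `c₅ = 40`, from the tree's one-logarithm estimates
`padicValRat_zpow_sub_one_mul_log_le'` (odd `p`) and `padicValRat_zpow_sub_one_mul_log_le_two` (`p = 2`).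
Stated as a theorem with the text inline (no cited `def`). WHAT THIS IS NOT: not the crux (all `#S`).
-/

set_option linter.dupNamespace false

namespace Summit.ABC.ABC.Theorems.PadicPrimesYuNinetyRung

open Finset Real Height
open Literature.NumberTheory.DiophantineGeometry

/-- Numerical door: `2·P·X + 2·Y + 1 < 40 · P² · Y · L₂ · X` for `P ≥ 2`, `X ≥ 1`, `Y ≥ 1`, `L₂ ≥ 0.27`. -/
theorem door {P X Y L₂ : ℝ} (hP : 2 ≤ P) (hX : 1 ≤ X) (hY : 1 ≤ Y) (hL : 0.27 ≤ L₂) :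
    2 * P * X + 2 * Y + 1 < 40 * P ^ 2 * Y * L₂ * X := by
  have hPXY : 0 ≤ P ^ 2 * X * Y := by positivity
  have h1 : 10.8 * (P ^ 2 * X * Y) ≤ 40 * P ^ 2 * Y * L₂ * X := by nlinarith
  have h2 : 2 * P * X ≤ P ^ 2 * X * Y := by nlinarith [mul_nonneg (mul_nonneg (by linarith : (0:ℝ) ≤ P - 2) (by linarith : (0:ℝ) ≤ X)) (by linarith : (0:ℝ) ≤ Y), mul_nonneg (mul_nonneg (by linarith : (0:ℝ) ≤ P) (by linarith : (0:ℝ) ≤ X)) (by linarith : (0:ℝ) ≤ Y - 1)]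
  have h3 : 4 * Y ≤ P ^ 2 * X * Y := by nlinarith [mul_nonneg (by nlinarith : (0:ℝ) ≤ P ^ 2 - 4) (by linarith : (0:ℝ) ≤ Y), mul_nonneg (mul_nonneg (sq_nonneg P) (by linarith : (0:ℝ) ≤ X - 1)) (by linarith : (0:ℝ) ≤ Y)]
  nlinarith

/-- `log (log (max 4 q)) ≥ 0.27` and `log (max 4 q) ≥ 1`, `log q ≤ log (max 4 q)`. -/
theorem loglog_max_four_ge (q : ℕ) : (0.27 : ℝ) ≤ Real.log (Real.log ((max 4 q : ℕ) : ℝ)) := by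
  have h4 : (4 : ℝ) ≤ ((max 4 q : ℕ) : ℝ) := by exact_mod_cast le_max_left 4 q
  have hlog4 : (1.38 : ℝ) ≤ Real.log ((max 4 q : ℕ) : ℝ) := by
    have h2 : (1.38 : ℝ) ≤ Real.log 4 := by
      have := Real.log_two_gt_d9
      have h : Real.log 4 = 2 * Real.log 2 := by
        rw [show (4:ℝ) = 2 ^ 2 by norm_num, Real.log_pow]; norm_num
      linarith
    exact h2.trans (Real.log_le_log (by norm_num) h4)
  have hpos : 0 < Real.log ((max 4 q : ℕ) : ℝ) := by linarith
  have := Real.one_sub_inv_le_log_of_pos hpos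
  have hinv : (Real.log ((max 4 q : ℕ) : ℝ))⁻¹ ≤ 1 / 1.38 := by
    rw [one_div]; exact inv_anti₀ (by norm_num) hlog4
  linarith [show (1:ℝ) - 1 / 1.38 ≥ 0.27 by norm_num]

/-- **BC5 rung of the M2 crux family: the one-prime-set case `#S ≤ 1`** of `YuNinetyPrimes` (the binder
`hY` of `Literature.Barriers.ABC.stewartYu1991_of_yu1990`), with `c₅ = 40`, from the tree's one-logarithm
estimates (`padicValRat_zpow_sub_one_mul_log_le'` for odd `p`, `…_le_two` for `p = 2`). [folklore] -/
theorem yuNinetyPrimes_card_one : ∃ c₅ : ℝ, ∀ (p : ℕ), p.Prime → ∀ (S : Finset ℕ), (∀ q ∈ S, q.Prime) → p ∉ S →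
      S.Nonempty → S.card ≤ 1 →
      ∀ (e : ℕ → ℤ) (B : ℝ), 3 ≤ B → (∀ q ∈ S, (|e q| : ℝ) ≤ B) →
      ∏ q ∈ S, (q : ℚ) ^ e q ≠ 1 →
      (padicValRat p (∏ q ∈ S, (q : ℚ) ^ e q - 1) : ℝ) <
        (c₅ * S.card) ^ S.card * (p : ℝ) ^ 2 * Real.log B *
          Real.log (Real.log ((max 4 (S.sup id) : ℕ) : ℝ)) *
          ∏ q ∈ S, Real.log ((max 4 q : ℕ) : ℝ) := by
  refine ⟨40, ?_⟩
  intro p hp S hS hpS hne hcard e B hB heB hne1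
  obtain ⟨q, rfl⟩ := Finset.card_eq_one.mp (le_antisymm hcard (Finset.card_pos.mpr hne))
  have hq : q.Prime := hS q (mem_singleton_self q)
  have hqp : q ≠ p := fun h => hpS (h ▸ mem_singleton_self q)
  simp only [prod_singleton, sup_singleton, id, card_singleton, Nat.cast_one, mul_one, pow_one] at hne1 heB ⊢
  set t : ℤ := e q with ht_def
  have ht : t ≠ 0 := by
    intro h0; apply hne1; rw [h0, zpow_zero]
  -- the quantities
  set X : ℝ := Real.log ((max 4 q : ℕ) : ℝ) with hX_def
  set Y : ℝ := Real.log B with hY_def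
  set L₂ : ℝ := Real.log (Real.log ((max 4 q : ℕ) : ℝ)) with hL_def
  have hL : (0.27 : ℝ) ≤ L₂ := loglog_max_four_ge q
  have h4 : (4 : ℝ) ≤ ((max 4 q : ℕ) : ℝ) := by exact_mod_cast le_max_left 4 q
  have hX1 : (1 : ℝ) ≤ X := by
    have h2 : (1 : ℝ) ≤ Real.log 4 := by
      have := Real.log_two_gt_d9
      have h : Real.log 4 = 2 * Real.log 2 := by
        rw [show (4:ℝ) = 2 ^ 2 by norm_num, Real.log_pow]; norm_num
      linarith
    exact h2.trans (Real.log_le_log (by norm_num) h4)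
  have hY1 : (1 : ℝ) ≤ Y := by
    have h3 : (1 : ℝ) ≤ Real.log 3 := by
      rw [← Real.log_exp 1]
      exact Real.log_le_log (Real.exp_pos 1) (by have := Real.exp_one_lt_d9; linarith)
    exact h3.trans (Real.log_le_log (by norm_num) hB)
  have hq0 : (q : ℚ) ≠ 0 := by exact_mod_cast hq.ne_zero
  have hqpos : (0 : ℝ) < q := by exact_mod_cast hq.pos
  have hlogq : Real.log q ≤ X := Real.log_le_log hqpos (by exact_mod_cast le_max_right 4 q)
  have hlogq0 : 0 ≤ Real.log q := Real.log_nonneg (by exact_mod_cast hq.one_lt.le)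
  have hlogt : Real.log |(t : ℝ)| ≤ Y := by
    have htpos : (0 : ℝ) < |(t : ℝ)| := abs_pos.mpr (by exact_mod_cast ht)
    exact Real.log_le_log htpos (heB q (mem_singleton_self q))
  have hP2 : (2 : ℝ) ≤ p := by exact_mod_cast hp.two_le
  have hdoor := door hP2 hX1 hY1 hL
  -- it suffices to bound `v ≤ 2 p X + Y + 1`
  suffices hv : (padicValRat p ((q : ℚ) ^ t - 1) : ℝ) ≤ 2 * p * X + 2 * Y + 1 by
    exact lt_of_le_of_lt hv hdoor
  have hqv : padicValRat p (q : ℚ) = 0 :=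
    Literature.Barriers.ABC.StewartTijdemanGeneric.padicValRat_natCast_prime_of_ne hp hq hqp
  have hh : logHeight₁ (q : ℚ) = Real.log q := by
    haveI : NeZero q := ⟨hq.ne_zero⟩
    exact Rat.logHeight₁_natCast q
  by_cases hv0 : (padicValRat p ((q : ℚ) ^ t - 1) : ℝ) < 0
  · nlinarith
  push Not at hv0
  rcases eq_or_ne p 2 with rfl | hp2
  · -- p = 2
    have h := Dioph.padicValRat_zpow_sub_one_mul_log_le_two hq0 hqv ht hne1
    rw [hh] at h
    have hl2 : (0.69 : ℝ) ≤ Real.log 2 := by have := Real.log_two_gt_d9; linarith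
    have hl2' : Real.log 2 ≤ 0.7 := by have := Real.log_two_lt_d9; linarith
    have h1 : (padicValRat 2 ((q : ℚ) ^ t - 1) : ℝ) * Real.log 2 ≤ 0.7 + 2 * X + Y := by
      linarith
    have h069 : (padicValRat 2 ((q : ℚ) ^ t - 1) : ℝ) * 0.69 ≤
        (padicValRat 2 ((q : ℚ) ^ t - 1) : ℝ) * Real.log 2 :=
      mul_le_mul_of_nonneg_left hl2 hv0
    push_cast
    linarith
  · -- p odd
    have hq1 : (q : ℚ) ≠ 1 := by exact_mod_cast hq.one_lt.ne'
    have hqm1 : (q : ℚ) ≠ -1 := by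
      have : (0 : ℚ) ≤ q := by exact_mod_cast (Nat.zero_le q)
      intro h; rw [h] at this; norm_num at this
    have h := Dioph.padicValRat_zpow_sub_one_mul_log_le' hp hp2 hq0 hqv hq1 hqm1 ht
    rw [hh, Nat.cast_natAbs, Int.cast_abs] at h
    have hlogp : (1 : ℝ) ≤ Real.log p := by
      have h3 : (3 : ℝ) ≤ p := by
        have := hp.two_le
        have h23 : p ≠ 2 := hp2
        exact_mod_cast (by omega : 3 ≤ p)
      have : (1 : ℝ) ≤ Real.log 3 := by
        rw [← Real.log_exp 1]
        exact Real.log_le_log (Real.exp_pos 1) (by have := Real.exp_one_lt_d9; linarith)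
      exact this.trans (Real.log_le_log (by norm_num) h3)
    have hv1 : (padicValRat p ((q : ℚ) ^ t - 1) : ℝ) ≤
        (padicValRat p ((q : ℚ) ^ t - 1) : ℝ) * Real.log p := by
      nlinarith
    have hp1 : 2 * ((p : ℝ) - 1) * Real.log q ≤ 2 * p * X := by nlinarith
    linarith


/-! ### BC5 rungs per crux of route `PadicPrimesYuNinety` (the one-prime case `S.card ≤ 1` of each residue class). -/

/-- BC5 rung for crux `YuNinetyThreeModFour`: its `S.card ≤ 1` case (restriction of `yuNinetyPrimes_card_one`). -/
theorem yuNinetyThreeModFour_rung : ∃ c₅ : ℝ, ∀ (p : ℕ), p.Prime → p % 4 = 3 →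
    ∀ (S : Finset ℕ), (∀ q ∈ S, q.Prime) → p ∉ S → S.Nonempty → S.card ≤ 1 →
      ∀ (e : ℕ → ℤ) (B : ℝ), 3 ≤ B → (∀ q ∈ S, (|e q| : ℝ) ≤ B) →
      ∏ q ∈ S, (q : ℚ) ^ e q ≠ 1 →
      (padicValRat p (∏ q ∈ S, (q : ℚ) ^ e q - 1) : ℝ) <
        (c₅ * S.card) ^ S.card * (p : ℝ) ^ 2 * Real.log B *
          Real.log (Real.log ((max 4 (S.sup id) : ℕ) : ℝ)) *
          ∏ q ∈ S, Real.log ((max 4 q : ℕ) : ℝ) := by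
  obtain ⟨c₅, h⟩ := yuNinetyPrimes_card_one
  exact ⟨c₅, fun p hp _ S hS hpS hne hcard e B hB heB hne1 => h p hp S hS hpS hne hcard e B hB heB hne1⟩

/-- BC5 rung for crux `YuNinetyOneModFour`: its `S.card ≤ 1` case. -/
theorem yuNinetyOneModFour_rung : ∃ c₅ : ℝ, ∀ (p : ℕ), p.Prime → p % 4 = 1 →
    ∀ (S : Finset ℕ), (∀ q ∈ S, q.Prime) → p ∉ S → S.Nonempty → S.card ≤ 1 →
      ∀ (e : ℕ → ℤ) (B : ℝ), 3 ≤ B → (∀ q ∈ S, (|e q| : ℝ) ≤ B) →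
      ∏ q ∈ S, (q : ℚ) ^ e q ≠ 1 →
      (padicValRat p (∏ q ∈ S, (q : ℚ) ^ e q - 1) : ℝ) <
        (c₅ * S.card) ^ S.card * (p : ℝ) ^ 2 * Real.log B *
          Real.log (Real.log ((max 4 (S.sup id) : ℕ) : ℝ)) *
          ∏ q ∈ S, Real.log ((max 4 q : ℕ) : ℝ) := by
  obtain ⟨c₅, h⟩ := yuNinetyPrimes_card_one
  exact ⟨c₅, fun p hp _ S hS hpS hne hcard e B hB heB hne1 => h p hp S hS hpS hne hcard e B hB heB hne1⟩

/-- BC5 rung for crux `YuNinetyTwo`: its `S.card ≤ 1` case (`p = 2`). -/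
theorem yuNinetyTwo_rung : ∃ c₅ : ℝ,
    ∀ (S : Finset ℕ), (∀ q ∈ S, q.Prime) → 2 ∉ S → S.Nonempty → S.card ≤ 1 →
      ∀ (e : ℕ → ℤ) (B : ℝ), 3 ≤ B → (∀ q ∈ S, (|e q| : ℝ) ≤ B) →
      ∏ q ∈ S, (q : ℚ) ^ e q ≠ 1 →
      (padicValRat 2 (∏ q ∈ S, (q : ℚ) ^ e q - 1) : ℝ) <
        (c₅ * S.card) ^ S.card * (2 : ℝ) ^ 2 * Real.log B *
          Real.log (Real.log ((max 4 (S.sup id) : ℕ) : ℝ)) *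
          ∏ q ∈ S, Real.log ((max 4 q : ℕ) : ℝ) := by
  obtain ⟨c₅, h⟩ := yuNinetyPrimes_card_one
  refine ⟨c₅, fun S hS h2S hne hcard e B hB heB hne1 => ?_⟩
  simpa only [Nat.cast_ofNat] using h 2 Nat.prime_two S hS h2S hne hcard e B hB heB hne1

end Summit.ABC.ABC.Theorems.PadicPrimesYuNinetyRung
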